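import Mathlib
import HarnessLib
import Summits.NavierStokesRegularity.NavierStokesRegularity.Theses.RootDecompPointVertex
import Summits.NavierStokesRegularity.NavierStokesRegularity.Theorems.RootDecompMarginalRateMarginalReduction
import Summits.NavierStokesRegularity.NavierStokesRegularity.Theorems.RootDecompThresholdSaddleLeanBadDatumExists
import Literature.Analysis.FluidPDE.SelfSimilar
import Literature.Analysis.FluidPDE.SuitableWeak
import Literature.Analysis.FluidPDE.ChaeWolfDSSDecayScaling

/-!
# `PointVertexToolkit` — the toolkit KIT of route `RootDecompPointVertex` (N12), proved

Item stmt-NavierStokesRegularity-29915, kind support, a load-bearing binder of the route's `closes`.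
KIT is the conjunction of three pieces:

1. R = `Theses.RootDecompMarginalRate.MarginalReduction` — the marginal-viscosity reduction, a tree
   theorem since p793251 (`Theorems.MarginalReduction.marginalReduction_proof`);
2. LBE = `Theses.RootDecompLeanestSingularity.LeanBadDatumExists` — lean bad data exist and stay lean up
   the viscosity ray, a tree theorem since p793515 (`Theorems.LeanBadDatumExists.leanBadDatumExists_proof`,
   stated there against the `RootDecompThresholdSaddle` copy of the decl; the two copies have the same
   body, so the proof term inhabits both);
3. ENV — the DECAY UPGRADE in blow-up form: for every `ν > 0`, every field `u` blowing up at the Type-I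
   rate at `T`, every vertex blow-up limit `U` of `u` at `T` (moving centres `xc k`, scales `lam k → 0⁺`,
   pointwise on `s < 0`) which is `(c, R)`-rotated-DSS with `c > 1` and bounded on the fundamental annulus
   `1 ≤ ‖x‖ ≤ c` over `−1 ≤ t < 0` has the space–time Type-I envelope `HasTypeIDecay C₀ U`.

ENV is proved here (port of the lens-4 g8 kernel, HOME/decomp-ns-lens-4/PointVertex.lean §9.3–9.4):
(a) the Type-I TIME rate is inherited by every vertex blow-up limit (`hasTypeITimeDecay_of_blowupLimit`:
the zoom times `T + lam_k² ν s ↑ T` enter the Type-I window, the bound `C/(√ν √(−s))` is `k`-independent,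
pointwise limits preserve `≤`); (b) a rotated-DSS field with the time rate and an annulus bound obeys the
SPATIAL rate `‖U t x‖ ≤ c·max(M, C)/‖x‖` (`rdss_norm_le_div_norm_of_annulus_bound`: carry `x` into the
annulus by the unique power `cⁿ`, `n ∈ ℤ` — Chae–Wolf 2017 §2 Step 5 run with the time rate); (c) the two
rates combine by the tree's `ChaeWolfDecay.hasTypeIDecay_of_time_and_space_decay`.

No new definitions.  Sources: Kato1984; LemarieRieusset2016; KNSS2009 §6; SereginSverak2009;
ChaeWolf2017 §2; doi:10.5802/aif.1983.
-/

set_option linter.dupNamespace false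

noncomputable section

open Literature.Analysis Literature.Analysis.FluidPDE MeasureTheory Set Function Filter Topology

namespace Summit.NavierStokesRegularity.NavierStokesRegularity.Theorems.PointVertexToolkit

/-! ## §1 Rotated-DSS scaling identities for the norm -/

section RDSS

variable {c : ℝ} {R : EuclideanSpace ℝ (Fin 3) ≃ₗᵢ[ℝ] EuclideanSpace ℝ (Fin 3)}
  {U : ℝ → EuclideanSpace ℝ (Fin 3) → EuclideanSpace ℝ (Fin 3)}

/-- One step UP the scaling: `‖U t x‖ = c ‖U (c² t) (c R x)‖` (`0 < c`). -/
theorem rdss_norm_eq_mul_norm (h : IsRotatedDSS c R U) (hc : 0 < c) (t : ℝ)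
    (x : EuclideanSpace ℝ (Fin 3)) : ‖U t x‖ = c * ‖U (c ^ 2 * t) (c • R x)‖ := by
  rw [← h t x, norm_smul, LinearIsometryEquiv.norm_map, Real.norm_of_nonneg hc.le]

/-- One step DOWN the scaling: `‖U t x‖ = c⁻¹ ‖U (t/c²) (c⁻¹ R⁻¹ x)‖` (`0 < c`). -/
theorem rdss_norm_eq_inv_mul_norm (h : IsRotatedDSS c R U) (hc : 0 < c) (t : ℝ)
    (x : EuclideanSpace ℝ (Fin 3)) : ‖U t x‖ = c⁻¹ * ‖U (t / c ^ 2) (c⁻¹ • R.symm x)‖ := by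
  have hc0 : c ≠ 0 := hc.ne'
  have key := h (t / c ^ 2) (c⁻¹ • R.symm x)
  have h1 : c ^ 2 * (t / c ^ 2) = t := by field_simp
  have h2 : c • R (c⁻¹ • R.symm x) = x := by
    rw [R.map_smul, R.apply_symm_apply, smul_smul, mul_inv_cancel₀ hc0, one_smul]
  rw [h1, h2] at key
  rw [← key, norm_smul, LinearIsometryEquiv.norm_map, Real.norm_of_nonneg hc.le, ← mul_assoc,
    inv_mul_cancel₀ hc0, one_mul]

/-- `n` steps up: `‖U t x‖ = cⁿ ‖U (c²ⁿ t) x'‖` at a point `x'` with `‖x'‖ = cⁿ ‖x‖`. -/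
theorem rdss_exists_norm_eq_pow_mul (h : IsRotatedDSS c R U) (hc : 0 < c) (n : ℕ) (t : ℝ)
    (x : EuclideanSpace ℝ (Fin 3)) :
    ∃ x' : EuclideanSpace ℝ (Fin 3), ‖x'‖ = c ^ n * ‖x‖ ∧
      ‖U t x‖ = c ^ n * ‖U ((c ^ n) ^ 2 * t) x'‖ := by
  induction n with
  | zero => exact ⟨x, by simp, by simp⟩
  | succ n ih =>
    obtain ⟨x', hx', hU⟩ := ih
    refine ⟨c • R x', ?_, ?_⟩
    · rw [norm_smul, LinearIsometryEquiv.norm_map, Real.norm_of_nonneg hc.le, hx']; ring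
    · have key := rdss_norm_eq_mul_norm h hc ((c ^ n) ^ 2 * t) x'
      have ht : c ^ 2 * ((c ^ n) ^ 2 * t) = (c ^ (n + 1)) ^ 2 * t := by ring
      rw [ht] at key
      rw [hU, key]; ring

/-- `n` steps down: `‖U t x‖ = ‖U (t/c²ⁿ) x'‖/cⁿ` at a point `x'` with `‖x'‖ = ‖x‖/cⁿ`. -/
theorem rdss_exists_norm_eq_div_pow (h : IsRotatedDSS c R U) (hc : 0 < c) (n : ℕ) (t : ℝ)
    (x : EuclideanSpace ℝ (Fin 3)) :
    ∃ x' : EuclideanSpace ℝ (Fin 3), ‖x'‖ = ‖x‖ / c ^ n ∧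
      ‖U t x‖ = ‖U (t / (c ^ n) ^ 2) x'‖ / c ^ n := by
  have hc0 : c ≠ 0 := hc.ne'
  induction n with
  | zero => exact ⟨x, by simp, by simp⟩
  | succ n ih =>
    obtain ⟨x', hx', hU⟩ := ih
    refine ⟨c⁻¹ • R.symm x', ?_, ?_⟩
    · rw [norm_smul, LinearIsometryEquiv.norm_map, Real.norm_of_nonneg (inv_nonneg.2 hc.le), hx',
        pow_succ]
      field_simp
    · have key := rdss_norm_eq_inv_mul_norm h hc (t / (c ^ n) ^ 2) x'
      have ht : t / (c ^ n) ^ 2 / c ^ 2 = t / (c ^ (n + 1)) ^ 2 := by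
        field_simp; ring
      rw [ht] at key
      rw [hU, key, pow_succ]
      field_simp
      ring

/-- **The spatial Type-I rate from an annulus bound.**  A `(c, R)`-rotated-DSS field (`c > 1`) with the
Type-I TIME rate `‖U t x‖ ≤ C/√(−t)` which is bounded by `M` on the fundamental annulus `1 ≤ ‖x‖ ≤ c`
over `−1 ≤ t < 0` obeys the SPATIAL rate `‖U t x‖ ≤ c·max(M, C)/‖x‖` at every `t < 0`, `x ≠ 0`
(Chae–Wolf 2017 §2 Step 5, run with the time rate in place of their regularity input). -/
theorem rdss_norm_le_div_norm_of_annulus_bound (hc : 1 < c) (h : IsRotatedDSS c R U)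
    {M C : ℝ} (hM : 0 ≤ M) (hC : 0 ≤ C) (htime : HasTypeITimeDecay C U)
    (hann : ∀ t : ℝ, -1 ≤ t → t < 0 →
      ∀ x : EuclideanSpace ℝ (Fin 3), 1 ≤ ‖x‖ → ‖x‖ ≤ c → ‖U t x‖ ≤ M) :
    ∀ t < 0, ∀ x : EuclideanSpace ℝ (Fin 3), x ≠ 0 → ‖U t x‖ ≤ c * max M C / ‖x‖ := by
  have hc0 : 0 < c := one_pos.trans hc
  -- the fundamental annulus is bounded by `max M C` at EVERY negative time
  have hK : ∀ t < 0, ∀ y : EuclideanSpace ℝ (Fin 3), 1 ≤ ‖y‖ → ‖y‖ ≤ c →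
      ‖U t y‖ ≤ max M C := by
    intro t ht y hy1 hyc
    by_cases h1 : -1 ≤ t
    · exact (hann t h1 ht y hy1 hyc).trans (le_max_left _ _)
    · have hs : 1 ≤ Real.sqrt (-t) := Real.le_sqrt_of_sq_le (by rw [one_pow]; linarith)
      calc ‖U t y‖ ≤ C / Real.sqrt (-t) := htime t ht y
        _ ≤ C := div_le_self hC hs
        _ ≤ max M C := le_max_right _ _
  have hK0 : 0 ≤ max M C := hM.trans (le_max_left _ _)
  intro t ht x hx
  have hxpos : 0 < ‖x‖ := norm_pos_iff.2 hx
  by_cases hx1 : 1 ≤ ‖x‖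
  · -- `c^n ≤ ‖x‖ < c^(n+1)`: go DOWN `n` steps
    obtain ⟨n, hn1, hn2⟩ := exists_nat_pow_near hx1 hc
    obtain ⟨x', hx', hU⟩ := rdss_exists_norm_eq_div_pow h hc0 n t x
    have hcn : 0 < c ^ n := pow_pos hc0 n
    have hxc : ‖x‖ ≤ c * c ^ n := by rw [pow_succ] at hn2; linarith
    have h1' : 1 ≤ ‖x'‖ := by rw [hx', le_div_iff₀ hcn, one_mul]; exact hn1
    have hc' : ‖x'‖ ≤ c := by rw [hx', div_le_iff₀ hcn]; exact hxc
    have ht' : t / (c ^ n) ^ 2 < 0 := div_neg_of_neg_of_pos ht (pow_pos hcn 2)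
    have hB := hK _ ht' x' h1' hc'
    rw [hU, div_le_div_iff₀ hcn hxpos]
    calc ‖U (t / (c ^ n) ^ 2) x'‖ * ‖x‖ ≤ max M C * (c * c ^ n) :=
          mul_le_mul hB hxc (norm_nonneg _) hK0
      _ = c * max M C * c ^ n := by ring
  · -- `c^{-(n+1)} < ‖x‖ ≤ c^{-n}`: go UP `n + 1` steps
    have hx1' : ‖x‖ < 1 := not_le.1 hx1
    obtain ⟨n, hn1, hn2⟩ :=
      exists_nat_pow_near_of_lt_one hxpos hx1'.le (inv_pos.2 hc0) (inv_lt_one_of_one_lt₀ hc)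
    obtain ⟨x', hx', hU⟩ := rdss_exists_norm_eq_pow_mul h hc0 (n + 1) t x
    have hcn : 0 < c ^ n := pow_pos hc0 n
    have hcn1 : 0 < c ^ (n + 1) := pow_pos hc0 (n + 1)
    have h2 : c ^ n * ‖x‖ ≤ 1 := by
      rw [inv_pow] at hn2
      calc c ^ n * ‖x‖ ≤ c ^ n * (c ^ n)⁻¹ := by gcongr
        _ = 1 := mul_inv_cancel₀ hcn.ne'
    have h3 : 1 ≤ c ^ (n + 1) * ‖x‖ := by
      rw [inv_pow] at hn1
      have := mul_lt_mul_of_pos_left hn1 hcn1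
      rw [mul_inv_cancel₀ hcn1.ne'] at this
      exact this.le
    have hxc : c ^ (n + 1) * ‖x‖ ≤ c := by
      calc c ^ (n + 1) * ‖x‖ = c * (c ^ n * ‖x‖) := by ring
        _ ≤ c * 1 := by gcongr
        _ = c := mul_one c
    have h1' : 1 ≤ ‖x'‖ := by rw [hx']; exact h3
    have hc' : ‖x'‖ ≤ c := by rw [hx']; exact hxc
    have ht' : (c ^ (n + 1)) ^ 2 * t < 0 := mul_neg_of_pos_of_neg (pow_pos hcn1 2) ht
    have hB := hK _ ht' x' h1' hc'
    rw [hU, le_div_iff₀ hxpos]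
    calc c ^ (n + 1) * ‖U ((c ^ (n + 1)) ^ 2 * t) x'‖ * ‖x‖
        = (c ^ (n + 1) * ‖x‖) * ‖U ((c ^ (n + 1)) ^ 2 * t) x'‖ := by ring
      _ ≤ c * max M C := mul_le_mul hxc hB (norm_nonneg _) hc0.le

/-- **The decay upgrade.**  A `(c, R)`-rotated-DSS field, `c > 1`, with the Type-I TIME rate and an
annulus bound on `1 ≤ ‖x‖ ≤ c`, `−1 ≤ t < 0` has the full space–time Type-I envelope
`‖U t x‖ ≤ C₀/(‖x‖ + √(−t))` (`HasTypeIDecay`), with an explicit `C₀ ≥ 0`. -/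
theorem hasTypeIDecay_of_annulus_bound (hc : 1 < c) (h : IsRotatedDSS c R U) {C : ℝ}
    (hC : 0 ≤ C) (htime : HasTypeITimeDecay C U)
    (hiso : ∃ M : ℝ, ∀ t : ℝ, -1 ≤ t → t < 0 →
      ∀ x : EuclideanSpace ℝ (Fin 3), 1 ≤ ‖x‖ → ‖x‖ ≤ c → ‖U t x‖ ≤ M) :
    ∃ C₀ : ℝ, 0 ≤ C₀ ∧ HasTypeIDecay C₀ U := by
  obtain ⟨M, hM⟩ := hiso
  have hc0 : 0 < c := one_pos.trans hc
  have hM0 : 0 ≤ max M 0 := le_max_right _ _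
  have hB0 : 0 ≤ c * max (max M 0) C := mul_nonneg hc0.le (hM0.trans (le_max_left _ _))
  have hspace := rdss_norm_le_div_norm_of_annulus_bound hc h hM0 hC htime
    (fun t h1 h2 x hx1 hxc => (hM t h1 h2 x hx1 hxc).trans (le_max_left _ _))
  refine ⟨_, ?_, ChaeWolfDecay.hasTypeIDecay_of_time_and_space_decay one_pos hC hB0 htime
    fun t ht x hx => hspace t ht x ?_⟩
  · exact (mul_nonneg hC (by norm_num)).trans (le_max_left _ _)
  · intro h0
    rw [h0, norm_zero, one_mul] at hx
    exact absurd hx (not_lt.2 (Real.sqrt_nonneg (-t)))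

end RDSS

/-! ## §2 Blow-up limits inherit the Type-I TIME rate -/

/-- **Time-Type-I is inherited.**  A vertex blow-up limit `U` (moving centres `xc k`, scales
`lam k → 0⁺`, pointwise on `s < 0`) of a Type-I blow-up `u` at `T` obeys `‖U s y‖ ≤ (max C 0/√ν)/√(−s)`
for all `s < 0`. -/
theorem hasTypeITimeDecay_of_blowupLimit {ν T : ℝ} (hν : 0 < ν)
    {u U : ℝ → EuclideanSpace ℝ (Fin 3) → EuclideanSpace ℝ (Fin 3)}
    (hTI : IsTypeIBlowup u T)
    (hlim : ∃ (xc : ℕ → EuclideanSpace ℝ (Fin 3)) (lam : ℕ → ℝ), (∀ k : ℕ, 0 < lam k) ∧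
      Tendsto lam atTop (𝓝 0) ∧ ∀ s : ℝ, s < 0 → ∀ y : EuclideanSpace ℝ (Fin 3),
        Tendsto (fun k : ℕ => lam k • u (T + lam k ^ 2 * ν * s) (xc k + (lam k * ν) • y)) atTop
          (𝓝 (U s y))) :
    ∃ C : ℝ, 0 ≤ C ∧ HasTypeITimeDecay C U := by
  obtain ⟨C, hC⟩ := hTI
  obtain ⟨xc, lam, hlam, hlam0, hconv⟩ := hlim
  refine ⟨max C 0 / Real.sqrt ν, div_nonneg (le_max_right _ _) (Real.sqrt_nonneg _), ?_⟩
  intro s hs y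
  have hns : 0 < -s := neg_pos.2 hs
  -- the zoom times tend to `T` from the left
  have hts : Tendsto (fun k => T + lam k ^ 2 * ν * s) atTop (𝓝[<] T) := by
    refine tendsto_nhdsWithin_iff.2 ⟨?_, Eventually.of_forall fun k => ?_⟩
    · have h1 : Tendsto (fun k => T + lam k ^ 2 * ν * s) atTop (𝓝 (T + 0 ^ 2 * ν * s)) :=
        tendsto_const_nhds.add (((hlam0.pow 2).mul_const ν).mul_const s)
      simpa using h1
    · have h2 : 0 < lam k ^ 2 * ν * (-s) := mul_pos (mul_pos (pow_pos (hlam k) 2) hν) hns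
      show T + lam k ^ 2 * ν * s < T
      linarith
  have hev : ∀ᶠ k in atTop,
      ‖lam k • u (T + lam k ^ 2 * ν * s) (xc k + (lam k * ν) • y)‖ ≤
        max C 0 / Real.sqrt ν / Real.sqrt (-s) := by
    filter_upwards [hts.eventually hC] with k hk
    have hl := hlam k
    have hTt : T - (T + lam k ^ 2 * ν * s) = lam k ^ 2 * (ν * (-s)) := by ring
    have hsq : Real.sqrt (lam k ^ 2 * (ν * (-s))) = lam k * (Real.sqrt ν * Real.sqrt (-s)) := by
      rw [Real.sqrt_mul (sq_nonneg _), Real.sqrt_sq hl.le, Real.sqrt_mul hν.le]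
    have h1 := hk (xc k + (lam k * ν) • y)
    rw [hTt, hsq] at h1
    rw [norm_smul, Real.norm_of_nonneg hl.le]
    calc lam k * ‖u (T + lam k ^ 2 * ν * s) (xc k + (lam k * ν) • y)‖
        ≤ lam k * (C / (lam k * (Real.sqrt ν * Real.sqrt (-s)))) := by gcongr
      _ = C / (Real.sqrt ν * Real.sqrt (-s)) := by
          rw [← mul_div_assoc, mul_div_mul_left C _ hl.ne']
      _ ≤ max C 0 / (Real.sqrt ν * Real.sqrt (-s)) := by gcongr; exact le_max_left _ _
      _ = max C 0 / Real.sqrt ν / Real.sqrt (-s) := by rw [div_div]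
  exact le_of_tendsto (hconv s hs y).norm hev

/-! ## §3 The three conjuncts and KIT -/

/-- ENV — the third conjunct of KIT, verbatim. -/
theorem env_proof : ∀ (ν T : ℝ), 0 < ν →
    ∀ (u U : ℝ → EuclideanSpace ℝ (Fin 3) → EuclideanSpace ℝ (Fin 3)) (c : ℝ)
      (R : EuclideanSpace ℝ (Fin 3) ≃ₗᵢ[ℝ] EuclideanSpace ℝ (Fin 3)),
      Literature.Analysis.FluidPDE.IsTypeIBlowup u T →
      (∃ (xc : ℕ → EuclideanSpace ℝ (Fin 3)) (lam : ℕ → ℝ), (∀ k : ℕ, 0 < lam k) ∧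
        Tendsto lam atTop (𝓝 0) ∧ ∀ s : ℝ, s < 0 → ∀ y : EuclideanSpace ℝ (Fin 3),
          Tendsto (fun k : ℕ => lam k • u (T + lam k ^ 2 * ν * s) (xc k + (lam k * ν) • y)) atTop
            (𝓝 (U s y))) →
      1 < c → Literature.Analysis.FluidPDE.IsRotatedDSS c R U →
      (∃ M : ℝ, ∀ t : ℝ, -1 ≤ t → t < 0 → ∀ x : EuclideanSpace ℝ (Fin 3),
        1 ≤ ‖x‖ → ‖x‖ ≤ c → ‖U t x‖ ≤ M) →
      ∃ C₀ : ℝ, Literature.Analysis.FluidPDE.HasTypeIDecay C₀ U := by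
  intro ν T hν u U c R hTI hlim hc hdss hiso
  obtain ⟨C, hC, htime⟩ := hasTypeITimeDecay_of_blowupLimit hν hTI hlim
  obtain ⟨C₀, -, hdec⟩ := hasTypeIDecay_of_annulus_bound hc hdss hC htime hiso
  exact ⟨C₀, hdec⟩

/-- LBE in the `RootDecompLeanestSingularity` currency (same body as the `RootDecompThresholdSaddle`
copy proved in `Theorems.LeanBadDatumExists.leanBadDatumExists_proof`). -/
theorem leanBadDatumExists_leanest : Theses.RootDecompLeanestSingularity.LeanBadDatumExists :=
  LeanBadDatumExists.leanBadDatumExists_proof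

/-- **KIT, the route decl** `RootDecompPointVertex.PointVertexToolkit` (item
stmt-NavierStokesRegularity-29915): ⟨R, LBE, ENV⟩. -/
theorem pointVertexToolkit_proof : Theses.RootDecompPointVertex.PointVertexToolkit :=
  ⟨MarginalReduction.marginalReduction_proof, leanBadDatumExists_leanest, env_proof⟩

end Summit.NavierStokesRegularity.NavierStokesRegularity.Theorems.PointVertexToolkit

end
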